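import Summits.QuantumFields.YangMills.Theorems.BalabanUVNodesN14SourceTowerOfRecord
import Summits.QuantumFields.YangMills.Theorems.BalabanUVNodesRateReadingOfRecord13CoPH

/-!
# DAG node N14 · NE1′ — THE SOURCE TOWER OF RECORD AT THE SPINE's OBJECTS: the booked size of `ne1OfRecord` CONTROLS the dressed partition functions
# `schemeZ` of the record two-sidedly (`e^{−size} ≤ Z_K(t)∕Z_K(0) ≤ e^{size}`, `|G_K(t)| ≤ size`, NO hypothesis at the datum of record), and the PROVISO-FREE
# door `ne1OfRecordFree` into dag-n22-e's `readingOfRecord₁₃CoPH w1 ℓ₃ ne2 ne1` currency (the `ne1` slot n27-c's leaves quantify over)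

Cell `pub-ymgap`, YM-PLAN Track A (HUMAN RULING D-0062 ∕ D-0149, director-ym №197), width seat `pub-ymgap-dag-n14-w1` (generation 2), FILE 4 of the seat.
THEOREMS + one `def` (the proviso-free door); imports FILE 3 `BalabanUVNodesN14SourceTowerOfRecord` and dag-n22-e's `BalabanUVNodesRateReadingOfRecord13CoPH` ONLY;
modifies nothing; `--supports` K3⁷ `SpineGivenEndpointR13SepCoPH` (stmt-QuantumFields-20544) `--as helper` — COUNT-NEUTRAL.

WHY.  (1) FILE 3's object of record books, at source `t` and cutoff `K`, the sup-size `|t| · sup_U |F_K U|` of the ONE dressed insertion `t·F_K` of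
`schemeZ ((datumOfRecord₁₃CoPH F N θ hP).scheme g₀) os K t` — the very functions K3⁷'s spine (`KeyedExtraction`, NE7 `Core`, U6's `genFun`) reads.  This file makes
the link a theorem: the booked size bounds U6's generating function `G_K(t) = log Z_K(t) − log Z_K(0)` (`T4CauchySum.genFun`) and sandwiches `Z_K(t)∕Z_K(0)`, at every
cutoff, with NO hypothesis at the datum of record (`β_K = (g₀ K)⁻² ≥ 0`; measurability from `Node00.isPrintedAveraged_datumOfRecord₁₃CoPH`; `|avgObs| ≤ 1`) — U6's
input `|G_K(t)| ≤ |t|` (`T4GenFunBounds.abs_genFun_schemeZ_le`) SHARPENED THROUGH THE TOWER (`size ≤ |t|`, FILE 3 `size_ne1OfRecord_le_unitScale`).  (2) dag-n27-c's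
composite leaves (`…HolderUnitScaleN14Producers` etc.) quantify over a PROVISO-FREE `ne1 : (F : T4Family) → Stage13HParams F N → (ℕ → ℝ) → List (ULoop F) →
NE1pCarriers` inside `readingOfRecord₁₃CoPH w1 ℓ₃ ne2 ne1`, with the pin as a hypothesis `hne1 : ∀ F θ hP, … → ne1 F θ g₀ os = <object> F θ hP g₀ os`; FILE 3's
`ne1OfRecord` READS `hP` (through the datum).  The door `ne1OfRecordFree l₀ Λ F θ g₀ os` (classical `dite` on `θ.Provisos₁₃CoPH F N`, proof-irrelevant; off the
provisos the model `sourceTower l₀ 1`) EQUALS `ne1OfRecord l₀ Λ F θ hP g₀ os` under `hP` (`ne1OfRecordFree_eq`), carries `N14At` and the guard UNCONDITIONALLY, and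
makes `readingOfRecord₁₃CoPH w1 ℓ₃ ne2 (ne1OfRecordFree l₀ Λ)` satisfy FILE 3's pin shape `Ne1PinnedOfRecord` — so the (t-N14) pin is available in BOTH currencies
(`𝔯.ne1` with provisos; n27-c's proviso-free `ne1`).

* §1 [bookkeeping, generic scheme] `schemeZ_div_le_exp_size` (`Z_K(t)∕Z_K(0) ≤ e^{size}`, no measurability), `exp_neg_size_le_schemeZ_div`, `abs_genFun_schemeZ_le_size`.
* §2 [object of record, NO hypothesis] `avgMeasurable_datumOfRecord₁₃CoPH`, ★★ `abs_genFun_le_size_ne1OfRecord` (`|G_K(t)| ≤ size`), ★ `schemeZ_div_le_exp_size_ne1OfRecord`,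
  ★ `exp_neg_size_le_schemeZ_div_ne1OfRecord`, `abs_genFun_le_topSize_ne1OfRecord` (`≤ l₀`, the budget), `abs_genFun_sub_le_ne1OfRecord` (equi-Lipschitz in the source).
* §3 [door] ★ `ne1OfRecordFree l₀ Λ`, `ne1OfRecordFree_eq` (= `ne1OfRecord` under `hP`), `n14At_ne1OfRecordFree` ∕ `nondegenerate_ne1OfRecordFree` (UNCONDITIONAL),
  ★ `ne1PinnedOfRecord_readingOfRecord₁₃CoPH` (the pin in n22-e's reading currency), `s_N14_rRec₁₃CoPHOn_readingOfRecord₁₃CoPH_free` ∕ `ne1NondegenerateOn_readingOfRecord₁₃CoPH_free`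
  (every regime), and the n27-c-facing hypothesis dischargers `hne1_ne1OfRecordFree` (the `hne1`-shape equation at every admissible tuple).
* §4 [R3 acceptance, decided] the pin EXCLUDES: any reading failing `N14At` or the guard at ONE tuple (`not_ne1PinnedOfRecord_of_not_n14At` ∕ `_of_not_nondegenerate`), K3⁷ v1
  evidence #5's EMPTY tower (`_of_isEmpty`), FILE 1 §4's DOUBLING tower at rate `1` (`not_ne1PinnedOfRecord_growing`).

HONEST FRAMING.  Bookkeeping over tree declarations BY NAME plus one proof-irrelevant door; the two-sided `Z` bounds and `|G_K| ≤ size` are the tree's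
`T4GenFunBounds` facts for bounded observables READ THROUGH FILE 3's booking — elementary, uniform in `K`, and exactly the content of NE1′ under reading (a) (the
observable budget); they are NOT NE7 ∕ matching ∕ `Σδ_K < ∞` (N19's content) and NOT NE1′ for sub-unit observables (NOT PRINTED, NOT PROVED).  Reading (a) is the
director's ADOPTED TABLE READING; N14 NOT discharged (chair's acts (i)–(v)); nothing of Bałaban's run is used beyond `|avgObs| ≤ 1`, `Averaging.iter _ 0 = id` and the
datum's measurable averaging; K3⁷ OPEN, not claimed; counts unmoved (typed 28∕28 · discharged 5∕27, A 5∕28).  The Yang–Mills mass gap (Clay) is NOT proved by any of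
this — R4 closes the conditional finite-𝕋⁴ rung `BalabanLadder.UV` only; NOT ℝ⁴, NOT OS, NOT a mass gap.
-/

noncomputable section

namespace YMDAG.N14.TopBorn

open Finset
open scoped BigOperators
open Literature.MathematicalPhysics.QuantumFieldTheory.Balaban1983to89
open Literature.MathematicalPhysics.QuantumFieldTheory.Balaban1983to89.T4Continuum
open Literature.MathematicalPhysics.QuantumFieldTheory.Balaban1983to89.T4TermFormat
open Literature.MathematicalPhysics.QuantumFieldTheory.Balaban1983to89.Missing (TorusScheme)
open Literature.MathematicalPhysics.QuantumFieldTheory.Balaban1983to89.T4GenFunBounds (prodObs schemeZ dressedZ abs_prodObs_le_one measurable_prodObs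
  dressedZ_div_le_exp exp_neg_le_dressedZ_div abs_log_dressedZ_sub_log_le)
open Summit.QuantumFields.BalabanUV.T4Continuum.NE1p.DressedRoot
open YMDAG.UVSplit
open YMDAG.N14.TowerGuard (Nondegenerate Ne1NondegenerateOn)
open Node00 (Stage13HParams RateObjects₁₁ NE3Letters₁₁ NE2Objects₁₁ MatA datumOfRecord₁₃CoPH isPrintedAveraged_datumOfRecord₁₃CoPH)
open Node00.W1 (ReadingData)

/-! ## §1 The booked size controls the dressed partition functions of the string (generic scheme, observables bounded by `1`) -/

section Spine

variable {G : Type*} [GaugeGroup G] [MeasurableSpace G] [HaarData G] [RegularGaugeGroup G] {O : Type*} (S : TorusScheme G O) (l₀ : ℝ) (os : List O)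

/-- **`Z_K(t)∕Z_K(0) ≤ e^{size(t,K)}`** [bookkeeping]: the ratio of dressed to undressed partition functions of the string at cutoff `K` is at most `e` to the booked
size of the source tower's insertion — `T4GenFunBounds.dressedZ_div_le_exp` with `B := sup_U |F_K U|`; `β_K ≥ 0`; NO measurability. [folklore] -/
theorem schemeZ_div_le_exp_size (hβ : ∀ K, 0 ≤ S.β K) (h1 : ∀ K o U, |S.obs K o U| ≤ 1) (t : {t : ℝ // |t| ≤ l₀}) (K : ℕ) (b : Unit) (k : ℕ) :
    schemeZ S os K t.1 / schemeZ S os K 0 ≤ Real.exp (((sourceTowerOfRecord S l₀ os).B t K).size b k) := by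
  rw [size_sourceTowerOfRecord, schemeZ, schemeZ]
  exact dressedZ_div_le_exp (S.P K) (hβ K) (abs_prodObs_le_obsSupNorm S h1 K os) t.1

/-- **`e^{−size(t,K)} ≤ Z_K(t)∕Z_K(0)`** [bookkeeping]: the lower half (`T4GenFunBounds.exp_neg_le_dressedZ_div`; measurable observables). [folklore] -/
theorem exp_neg_size_le_schemeZ_div (hβ : ∀ K, 0 ≤ S.β K) (hm : ∀ K o, Measurable (S.obs K o)) (h1 : ∀ K o U, |S.obs K o U| ≤ 1)
    (t : {t : ℝ // |t| ≤ l₀}) (K : ℕ) (b : Unit) (k : ℕ) :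
    Real.exp (-((sourceTowerOfRecord S l₀ os).B t K).size b k) ≤ schemeZ S os K t.1 / schemeZ S os K 0 := by
  rw [size_sourceTowerOfRecord, schemeZ, schemeZ]
  exact exp_neg_le_dressedZ_div (S.P K) (hβ K) (measurable_prodObs S hm K os) (abs_prodObs_le_obsSupNorm S h1 K os) t.1

/-- **`|G_K(t)| ≤ size(t,K)`** [bookkeeping]: U6's generating function `genFun (schemeZ S os) K t = log Z_K(t) − log Z_K(0)` (`T4CauchySum.genFun`) is bounded by the
booked size of the source tower's insertion at every cutoff — `T4GenFunBounds.abs_genFun_schemeZ_le` (`≤ |t|`) sharpened through the tower. [folklore] -/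
theorem abs_genFun_schemeZ_le_size (hβ : ∀ K, 0 ≤ S.β K) (hm : ∀ K o, Measurable (S.obs K o)) (h1 : ∀ K o U, |S.obs K o U| ≤ 1)
    (t : {t : ℝ // |t| ≤ l₀}) (K : ℕ) (b : Unit) (k : ℕ) :
    |T4CauchySum.genFun (schemeZ S os) K t.1| ≤ ((sourceTowerOfRecord S l₀ os).B t K).size b k := by
  rw [size_sourceTowerOfRecord, T4CauchySum.genFun, schemeZ, schemeZ]
  exact abs_log_dressedZ_sub_log_le (S.P K) (hβ K) (measurable_prodObs S hm K os) (abs_prodObs_le_obsSupNorm S h1 K os) t.1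

end Spine

/-! ## §2 At the datum of record: NO hypothesis -/

section Record

variable {N : ℕ} [NeZero N] {l₀ Λ : ℝ} (F : T4Family) (θ : Stage13HParams F N) (hP : θ.Provisos₁₃CoPH F N) (g₀ : ℕ → ℝ) (os : List (ULoop F))

/-- The datum of record has measurable averaging maps (def-T's `isPrintedAveraged_datumOfRecord₁₃CoPH` + `IsPrintedAveraged.avgMeasurable`). [folklore] -/
theorem avgMeasurable_datumOfRecord₁₃CoPH : (datumOfRecord₁₃CoPH F N θ hP).AvgMeasurable :=
  (isPrintedAveraged_datumOfRecord₁₃CoPH F N θ hP).avgMeasurable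

/-- The scheme of the datum of record has nonnegative inverse couplings `β_K = (g₀ K)⁻²`. [folklore] -/
theorem scheme_β_nonneg_datumOfRecord₁₃CoPH (K : ℕ) : 0 ≤ ((datumOfRecord₁₃CoPH F N θ hP).scheme g₀).β K := sq_nonneg _

/-- The scheme of the datum of record has measurable observables (averaged loop variables). [folklore] -/
theorem scheme_obs_measurable_datumOfRecord₁₃CoPH (K : ℕ) (C : ULoop F) : Measurable (((datumOfRecord₁₃CoPH F N θ hP).scheme g₀).obs K C) :=
  (datumOfRecord₁₃CoPH F N θ hP).measurable_avgObs (avgMeasurable_datumOfRecord₁₃CoPH F θ hP) K C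

/-- **`|G_K(t)| ≤ size(t,K)` AT THE RECORD, NO HYPOTHESIS** [object of record]: U6's generating function of the record's dressed partition functions is bounded, at every
cutoff `K` and every source `|t| ≤ l₀`, by the booked size of FILE 3's object of record `ne1OfRecord l₀ Λ F θ hP g₀ os`. [folklore] -/
theorem abs_genFun_le_size_ne1OfRecord (t : {t : ℝ // |t| ≤ l₀}) (K : ℕ) (b : Unit) (k : ℕ) :
    |T4CauchySum.genFun (schemeZ ((datumOfRecord₁₃CoPH F N θ hP).scheme g₀) os) K t.1| ≤ ((ne1OfRecord l₀ Λ F θ hP g₀ os).𝒯.B t K).size b k :=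
  abs_genFun_schemeZ_le_size ((datumOfRecord₁₃CoPH F N θ hP).scheme g₀) l₀ os (scheme_β_nonneg_datumOfRecord₁₃CoPH F θ hP g₀)
    (scheme_obs_measurable_datumOfRecord₁₃CoPH F θ hP g₀) (fun K C U => (datumOfRecord₁₃CoPH F N θ hP).abs_avgObs_le_one K C U) t K b k

/-- **`Z_K(t)∕Z_K(0) ≤ e^{size(t,K)}` AT THE RECORD, NO HYPOTHESIS** [object of record]. [folklore] -/
theorem schemeZ_div_le_exp_size_ne1OfRecord (t : {t : ℝ // |t| ≤ l₀}) (K : ℕ) (b : Unit) (k : ℕ) :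
    schemeZ ((datumOfRecord₁₃CoPH F N θ hP).scheme g₀) os K t.1 / schemeZ ((datumOfRecord₁₃CoPH F N θ hP).scheme g₀) os K 0 ≤
      Real.exp (((ne1OfRecord l₀ Λ F θ hP g₀ os).𝒯.B t K).size b k) :=
  schemeZ_div_le_exp_size ((datumOfRecord₁₃CoPH F N θ hP).scheme g₀) l₀ os (scheme_β_nonneg_datumOfRecord₁₃CoPH F θ hP g₀)
    (fun K C U => (datumOfRecord₁₃CoPH F N θ hP).abs_avgObs_le_one K C U) t K b k

/-- **`e^{−size(t,K)} ≤ Z_K(t)∕Z_K(0)` AT THE RECORD, NO HYPOTHESIS** [object of record]. [folklore] -/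
theorem exp_neg_size_le_schemeZ_div_ne1OfRecord (t : {t : ℝ // |t| ≤ l₀}) (K : ℕ) (b : Unit) (k : ℕ) :
    Real.exp (-((ne1OfRecord l₀ Λ F θ hP g₀ os).𝒯.B t K).size b k) ≤
      schemeZ ((datumOfRecord₁₃CoPH F N θ hP).scheme g₀) os K t.1 / schemeZ ((datumOfRecord₁₃CoPH F N θ hP).scheme g₀) os K 0 :=
  exp_neg_size_le_schemeZ_div ((datumOfRecord₁₃CoPH F N θ hP).scheme g₀) l₀ os (scheme_β_nonneg_datumOfRecord₁₃CoPH F θ hP g₀)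
    (scheme_obs_measurable_datumOfRecord₁₃CoPH F θ hP g₀) (fun K C U => (datumOfRecord₁₃CoPH F N θ hP).abs_avgObs_le_one K C U) t K b k

/-- **`|G_K(t)| ≤ l₀` AT THE RECORD** [object of record]: the observable budget (FILE 3 `towerTopSizeLe_ne1OfRecord`, read at rate `0`) bounds U6's generating function
uniformly in the cutoff and the source. [folklore] -/
theorem abs_genFun_le_topSize_ne1OfRecord (t : {t : ℝ // |t| ≤ l₀}) (K : ℕ) :
    |T4CauchySum.genFun (schemeZ ((datumOfRecord₁₃CoPH F N θ hP).scheme g₀) os) K t.1| ≤ l₀ :=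
  (abs_genFun_le_size_ne1OfRecord (Λ := 0) F θ hP g₀ os t K () K).trans (towerTopSizeLe_ne1OfRecord (Λ := 0) F θ hP g₀ os t K ())

/-- **EQUI-LIPSCHITZ IN THE SOURCE AT THE RECORD, NO HYPOTHESIS** [bookkeeping]: `|G_K(t) − G_K(s)| ≤ |t − s|` (`T4GenFunBounds.abs_genFun_schemeZ_sub_le`). [folklore] -/
theorem abs_genFun_sub_le_datumOfRecord₁₃CoPH (K : ℕ) (s t : ℝ) :
    |T4CauchySum.genFun (schemeZ ((datumOfRecord₁₃CoPH F N θ hP).scheme g₀) os) K t -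
        T4CauchySum.genFun (schemeZ ((datumOfRecord₁₃CoPH F N θ hP).scheme g₀) os) K s| ≤ |t - s| :=
  T4GenFunBounds.abs_genFun_schemeZ_sub_le _ (scheme_β_nonneg_datumOfRecord₁₃CoPH F θ hP g₀) (scheme_obs_measurable_datumOfRecord₁₃CoPH F θ hP g₀)
    (fun K C U => (datumOfRecord₁₃CoPH F N θ hP).abs_avgObs_le_one K C U) K os s t

end Record

/-! ## §3 The proviso-free door `ne1OfRecordFree` into `readingOfRecord₁₃CoPH w1 ℓ₃ ne2 ne1` -/

section Free

variable {N : ℕ} [NeZero N]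

open Classical in
/-- **THE PROVISO-FREE DOOR** [object of record]: at a Stage-13 tuple WITH its core provisos the object of record `ne1OfRecord l₀ Λ F θ hP g₀ os` (any proof `hP` — proof
irrelevant); off the provisos (junk tuples, never read by any keyed statement) FILE 1's model carriers `⟨{t // |t| ≤ l₀}, sourceTower l₀ 1, Λ⟩`.  The shape n27-c's
composite leaves quantify over (`ne1 : (F : T4Family) → Stage13HParams F N → (ℕ → ℝ) → List (ULoop F) → NE1pCarriers`). [folklore] -/
def ne1OfRecordFree (l₀ Λ : ℝ) (F : T4Family) (θ : Stage13HParams F N) (g₀ : ℕ → ℝ) (os : List (ULoop F)) : NE1pCarriers :=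
  if hP : θ.Provisos₁₃CoPH F N then ne1OfRecord l₀ Λ F θ hP g₀ os else ⟨{t : ℝ // |t| ≤ l₀}, sourceTower l₀ 1 zero_le_one, Λ⟩

variable {l₀ Λ : ℝ} (F : T4Family) (θ : Stage13HParams F N) (g₀ : ℕ → ℝ) (os : List (ULoop F))

/-- **UNDER THE PROVISOS THE DOOR IS THE OBJECT OF RECORD** (`dif_pos`, proof irrelevance). [folklore] -/
theorem ne1OfRecordFree_eq (hP : θ.Provisos₁₃CoPH F N) : ne1OfRecordFree l₀ Λ F θ g₀ os = ne1OfRecord l₀ Λ F θ hP g₀ os :=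
  dif_pos hP

/-- Off the provisos the door is FILE 1's model carriers (`dif_neg`). [folklore] -/
theorem ne1OfRecordFree_eq_of_not (hP : ¬ θ.Provisos₁₃CoPH F N) :
    ne1OfRecordFree l₀ Λ F θ g₀ os = ⟨{t : ℝ // |t| ≤ l₀}, sourceTower l₀ 1 zero_le_one, Λ⟩ :=
  dif_neg hP

/-- **`N14At` ON THE DOOR, UNCONDITIONALLY** [object of record + bookkeeping]: `0 ≤ l₀`, `0 ≤ Λ` (FILE 3 `n14At_ne1OfRecord` ∕ FILE 1 `n14At_sourceTower`). [folklore] -/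
theorem n14At_ne1OfRecordFree (hl₀ : 0 ≤ l₀) (hΛ : 0 ≤ Λ) : N14At (ne1OfRecordFree l₀ Λ F θ g₀ os) := by
  by_cases hP : θ.Provisos₁₃CoPH F N
  · rw [ne1OfRecordFree_eq F θ g₀ os hP]
    exact n14At_ne1OfRecord F θ hP g₀ os hl₀ hΛ
  · rw [ne1OfRecordFree_eq_of_not F θ g₀ os hP]
    exact n14At_sourceTower hl₀ zero_le_one hΛ

/-- **THE GUARD OF RECORD ON THE DOOR, UNCONDITIONALLY** [object of record + decided]: `0 < l₀` (FILE 3 `nondegenerate_ne1OfRecord` ∕ FILE 2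
`nondegenerate_ne1UnitScale` at `M = 1`). [folklore] -/
theorem nondegenerate_ne1OfRecordFree (hl₀ : 0 < l₀) : Nondegenerate (ne1OfRecordFree l₀ Λ F θ g₀ os) := by
  by_cases hP : θ.Provisos₁₃CoPH F N
  · rw [ne1OfRecordFree_eq F θ g₀ os hP]
    exact nondegenerate_ne1OfRecord F θ hP g₀ os hl₀
  · rw [ne1OfRecordFree_eq_of_not F θ g₀ os hP]
    exact ⟨nonempty_sourceWindow hl₀.le, birthsNonempty_sourceTower zero_le_one, notVacuum_sourceTower hl₀ one_pos⟩

/-- **THE n27-c-FACING EQUATION** [bookkeeping]: the door meets the `hne1`-shape hypothesis of dag-n27-c's composite leaves at the object of record — at EVERY Stage-13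
tuple with provisos (a fortiori at every admissible one), `ne1OfRecordFree l₀ Λ F θ g₀ os = ne1OfRecord l₀ Λ F θ hP g₀ os`. [folklore] -/
theorem hne1_ne1OfRecordFree (l₀ Λ : ℝ) :
    ∀ (F : T4Family) (θ : Stage13HParams F N) (hP : θ.Provisos₁₃CoPH F N), θ.Admissible F N → ∀ (g₀ : ℕ → ℝ) (os : List (ULoop F)),
      ne1OfRecordFree l₀ Λ F θ g₀ os = ne1OfRecord l₀ Λ F θ hP g₀ os :=
  fun F θ hP _ g₀ os => ne1OfRecordFree_eq F θ g₀ os hP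

variable (w1 : (F : T4Family) → (θ : Stage13HParams F N) → ReadingData F (MatA N) θ.τ9.M) (ℓ₃ : T4Family → NE3Letters₁₁)
  (ne2 : (F : T4Family) → Stage13HParams F N → (ℕ → ℝ) → List (ULoop F) → ℕ → NE2Objects₁₁)
  (Rg : (F : T4Family) → Stage13HParams F N → Prop)

/-- **THE (t-N14) PIN IN dag-n22-e's READING CURRENCY** [bookkeeping]: `readingOfRecord₁₃CoPH w1 ℓ₃ ne2 (ne1OfRecordFree l₀ Λ)` satisfies FILE 3's `Ne1PinnedOfRecord` for
`0 < l₀`, `0 ≤ Λ` (its `ne1` at `(F, θ, hP, g₀, os)` IS the door, `rfl`, hence the object of record, `dif_pos`). [folklore] -/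
theorem ne1PinnedOfRecord_readingOfRecord₁₃CoPH (hl₀ : 0 < l₀) (hΛ : 0 ≤ Λ) :
    Ne1PinnedOfRecord (readingOfRecord₁₃CoPH w1 ℓ₃ ne2 (ne1OfRecordFree l₀ Λ)) :=
  ⟨l₀, Λ, hl₀, hΛ, fun F θ hP g₀ os => ne1OfRecordFree_eq F θ g₀ os hP⟩

/-- **`S_N14` AT EVERY REGIME for the reading of record with the door in its `ne1` slot** [bookkeeping] (`0 < l₀`, `0 ≤ Λ`). [folklore] -/
theorem s_N14_rRec₁₃CoPHOn_readingOfRecord₁₃CoPH_free (hl₀ : 0 < l₀) (hΛ : 0 ≤ Λ) :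
    S_N14 (RRec₁₃CoPHOn (readingOfRecord₁₃CoPH w1 ℓ₃ ne2 (ne1OfRecordFree l₀ Λ)) Rg) :=
  (guard_and_s_N14_of_ne1PinnedOfRecord _ Rg (ne1PinnedOfRecord_readingOfRecord₁₃CoPH w1 ℓ₃ ne2 hl₀ hΛ)).2

/-- **THE KEYED GUARD OF RECORD AT EVERY REGIME for the reading of record with the door in its `ne1` slot** [bookkeeping] (`0 < l₀`, `0 ≤ Λ`). [folklore] -/
theorem ne1NondegenerateOn_readingOfRecord₁₃CoPH_free (hl₀ : 0 < l₀) (hΛ : 0 ≤ Λ) :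
    Ne1NondegenerateOn (readingOfRecord₁₃CoPH w1 ℓ₃ ne2 (ne1OfRecordFree l₀ Λ)) Rg :=
  (guard_and_s_N14_of_ne1PinnedOfRecord _ Rg (ne1PinnedOfRecord_readingOfRecord₁₃CoPH w1 ℓ₃ ne2 hl₀ hΛ)).1

end Free

/-! ## §4 R3 acceptance for the pin: readings the pin EXCLUDES (the junk of K3⁷ v1 evidence #5 and FILE 1's located doubling tower) -/

section R3

variable {N : ℕ} [NeZero N] (𝔯 : RateReading₁₃CoPH N)

/-- **THE PIN IMPLIES `N14At` EVERYWHERE, so a reading failing `N14At` at ONE Stage-13 tuple with provisos is NOT pinned** [decided]. [folklore] -/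
theorem not_ne1PinnedOfRecord_of_not_n14At {F : T4Family} (θ : Stage13HParams F N) (hP : θ.Provisos₁₃CoPH F N) (g₀ : ℕ → ℝ) (os : List (ULoop F))
    (h : ¬ N14At (𝔯.ne1 F θ hP g₀ os)) : ¬ Ne1PinnedOfRecord 𝔯 := by
  rintro ⟨l₀, Λ, hl₀, hΛ, hpin⟩
  rw [hpin F θ hP g₀ os] at h
  exact h (n14At_ne1OfRecord F θ hP g₀ os hl₀.le hΛ)

/-- **… and a reading failing dag-n14-w2's guard of record at ONE tuple is NOT pinned** [decided]. [folklore] -/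
theorem not_ne1PinnedOfRecord_of_not_nondegenerate {F : T4Family} (θ : Stage13HParams F N) (hP : θ.Provisos₁₃CoPH F N) (g₀ : ℕ → ℝ) (os : List (ULoop F))
    (h : ¬ Nondegenerate (𝔯.ne1 F θ hP g₀ os)) : ¬ Ne1PinnedOfRecord 𝔯 := by
  rintro ⟨l₀, Λ, hl₀, -, hpin⟩
  rw [hpin F θ hP g₀ os] at h
  exact h (nondegenerate_ne1OfRecord F θ hP g₀ os hl₀)

/-- R3 (i): a reading whose dressed-tower index is EMPTY at one tuple (K3⁷ v1 evidence #5's `DressedTower PEmpty`) is NOT pinned. [folklore] -/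
theorem not_ne1PinnedOfRecord_of_isEmpty {F : T4Family} (θ : Stage13HParams F N) (hP : θ.Provisos₁₃CoPH F N) (g₀ : ℕ → ℝ) (os : List (ULoop F))
    [IsEmpty (𝔯.ne1 F θ hP g₀ os).P] : ¬ Ne1PinnedOfRecord 𝔯 :=
  not_ne1PinnedOfRecord_of_not_nondegenerate 𝔯 θ hP g₀ os (YMDAG.N14.TowerGuard.not_nondegenerate_of_isEmpty _)

/-- R3 (ii): the DOUBLING-TOWER reading at rate `1` (FILE 1 §4's located refuter, dag-n14-a's `not_n14At_growing_one`) is NOT pinned — given one Stage-13 tuple with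
provisos to read it at. [folklore] -/
theorem not_ne1PinnedOfRecord_growing
    (lit : (F : T4Family) → (θ : Stage13HParams F N) → θ.Provisos₁₃CoPH F N → (ℕ → ℝ) → List (ULoop F) → RateObjects₁₁ N)
    {F : T4Family} (θ : Stage13HParams F N) (hP : θ.Provisos₁₃CoPH F N) :
    ¬ Ne1PinnedOfRecord (⟨lit, fun _ _ _ _ _ => ⟨Unit, growingTower, 1⟩⟩ : RateReading₁₃CoPH N) :=
  not_ne1PinnedOfRecord_of_not_n14At _ θ hP (fun _ => 0) [] not_n14At_growing_one

end R3

end YMDAG.N14.TopBorn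

end
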